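import Literature.Probability.LatticeModels.DobrushinShlosmanWeightedInfiniteVolumeStates
import Summits.Ventures.YMGap.RobustBall.StarDoorZdPerturbed
import Summits.Ventures.YMGap.RobustBall.MassGapOnBallS
import HarnessLib

/-!
# Venture YMGap, track ROBUST-BALL (Y2) — crux Y2-X2-WZd, step 1: the vertex-star door on `ℤ^d` for
# window arrays of ARBITRARY RANGE (weighted received sums), directly in infinite volume

HONEST FRAMING. WHAT THIS IS: a venture file (cell `pub-ymgap`, track Y2 ROBUST-BALL, seat ds-2).
The twin of `StarDoorZd.lean` / `StarDoorZdPerturbed.lean` (the radius-`D` star door) WITHOUT a locality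
radius: for ANY specification `γ` on the links of `ℤ^d` with `SU(N)` spins the file TYPES the weighted star
window bound `StarWindowBoundZdW γ t ρ reach r` — an array `K(s; y → x) ≥ 0` over ALL boundary links `y` with
the GLOBAL window contraction (H1) of the star kernels (all pairs of exteriors at once, Föllmer's (2.20) form)
and the WEIGHTED per-star received sum `Σ'_y K(s; y → x) e^{t·reach(s, y)} ≤ ρ` — and PROVES, for `ρ < 1`,
`t > 0` and the Frobenius weight:
* `hasUniqueGibbsMeasure_of_starWindowBoundZdW` — AT MOST ONE Gibbs measure, plus existence from a
  nonemptiness hypothesis (Literature `DobrushinShlosman.subsingleton_gibbsMeasures_of_window_weighted`,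
  the weighted Dobrushin–Shlosman uniqueness theorem for window kernels of infinite range, fed with the
  exhaustion `exists_starExhaustionW`);
* `abs_covariance_le_of_starWindowBoundZdW` — EXPONENTIAL CLUSTERING OF EVERY GIBBS MEASURE directly in
  infinite volume: `|cov_μ(f, g)| ≤ 2(2√N)² e^{2t} e^{−t·dist(Δf, Δg)} (Σ δf)(Σ δg)`
  (Literature `DobrushinShlosman.abs_covariance_le_of_window_weighted_exp`, fed with the two-set profile
  `exists_starProfileW`);
* `perturbedMassGapAtS_of_starWindowBoundZdW` — the plug into the track's TIER-2 `ℤ^d` currency: for a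
  link-summable potential `W` (continuous terms depending on their own links) the weighted star window bound
  for rb-p1's summable specification `perturbedYMS (fundamentalRep (Fin N)) (N β) W` gives
  `PerturbedMassGapAtS d N β W` (unique DLR state + Shen–Zhu–Zhu clustering, rate `t`,
  `c₁ = 2(2√N)² n² e^{2t}`).
This is the door of crux Y2-X2-WZd (the robust vertex-star door on the tier-2, infinite-range `ℤ^d` ball);
the array is constructed in the chart files. WHAT THIS IS NOT: no array, no number; strong-coupling LATTICE
bookkeeping — `ρ < 1` is where the window bound closes, not a transition; nothing about the continuum or
the Millennium problem.

## References
* R. L. Dobrushin, S. B. Shlosman, in *Statistical Physics and Dynamical Systems* (1985), Thm. 1;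
  H. Föllmer, LNM 1362 (1988) Ch. I (2.13)–(2.14), (2.20); H.-O. Georgii (2011) Thm. 8.7, Remark 8.26.
* The tree: `DobrushinShlosmanWeightedInfiniteVolume(States).lean` (lit, this seat), `RobustBall/StarDoorZd.lean`,
  `RobustBall/StarDoorZdPerturbed.lean` (g8, followed line by line), `RobustBall/MassGapOnBallS.lean` (rb-p1).
-/

noncomputable section

open MeasureTheory ProbabilityTheory Function Finset Real
open scoped NNReal
open Literature.Probability.LatticeModels
open Literature.Probability.LatticeModels.DobrushinMetric (IsLipBound)
open Literature.MathematicalPhysics.QuantumLattice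
open Literature.MathematicalPhysics.QuantumFieldTheory (suFrobDist suFrobDist_nonneg suFrobDist_le
  suFrobDist_self suEntries dist_suEntries_le_suFrobDist measurableSpace_specialUnitaryGroup_eq_comap
  setDistEdges linkSetDist linkSetDist_nonneg linkSetDist_eq_zero_of_mem setDistEdges_le_linkSetDist
  setDistEdges_nonneg)
open Summit.Ventures.YMGap.DSWindowZd

namespace Summit.Ventures.YMGap.RobustBall

variable {d N : ℕ}

/-! ### Sup-norm bookkeeping: `‖a‖ = supNormZd a` -/

/-- The real sup-norm of a site of `ℤ^d` is its integer sup-norm: `‖a‖ ≤ supNormZd a`. [folklore] -/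
theorem norm_le_supNormZd (a : Site d) : ‖a‖ ≤ (supNormZd a : ℝ) :=
  norm_le_of_natAbs_le (natAbs_le_supNormZd a)

/-- … and `supNormZd a ≤ ‖a‖`. [folklore] -/
theorem supNormZd_le_norm (a : Site d) : (supNormZd a : ℝ) ≤ ‖a‖ := by
  have h1 : ∀ i, ((a i).natAbs : ℝ) ≤ ‖a‖ := fun i => by
    rw [Nat.cast_natAbs, Int.cast_abs, ← Int.norm_eq_abs]
    exact norm_le_pi_norm a i
  have h2 : supNormZd a ≤ ⌊‖a‖⌋₊ :=
    supNormZd_le_iff.2 fun i => Nat.le_floor (h1 i)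
  exact (Nat.cast_le.2 h2).trans (Nat.floor_le (norm_nonneg _))

/-- `supNormZd` is `1`-Lipschitz for the real sup-norm: `supNormZd a ≤ supNormZd b + ‖a - b‖`. [folklore] -/
theorem supNormZd_le_supNormZd_add_norm (a b : Site d) : (supNormZd a : ℝ) ≤ supNormZd b + ‖a - b‖ := by
  have h : supNormZd a ≤ supNormZd b + supNormZd (a - b) :=
    supNormZd_le_add fun i => by
      have := natAbs_le_supNormZd (a - b) i
      rwa [Pi.sub_apply] at this
  calc (supNormZd a : ℝ) ≤ ((supNormZd b + supNormZd (a - b) : ℕ) : ℝ) := by exact_mod_cast h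
    _ = supNormZd b + (supNormZd (a - b) : ℝ) := by push_cast; ring
    _ ≤ supNormZd b + ‖a - b‖ := by linarith [supNormZd_le_norm (a - b)]

/-! ### The hypothesis schema: the weighted star window bound (arbitrary range) -/

variable (d N) in
/-- **The weighted star window bound on `ℤ^d` with rate `t`, received sum `≤ ρ` and reach `reach`** for a
specification `γ` on the links of `ℤ^d` with `SU(N)` spins and a link weight `r`: there is a vertex-indexed
array `K(s; y → x) ≥ 0` over ALL boundary links `y` (no locality radius), with weighted-summable columns,
such that (H1, GLOBAL form) for every centre `c`, ALL pairs of exterior fields `ω, η`, and every bounded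
measurable star-local `f` with link-Lipschitz vector `δ ≥ 0`,
`|γ_⋆ f(ω) − γ_⋆ f(η)| ≤ Σ_{x ∈ ⋆} δ x · Σ'_y K(c.1; y → x) r(ω_y, η_y)`, and (H2, WEIGHTED) the per-star received
sum `Σ'_y K(s; y → x) e^{t · reach(s, y)} ≤ ρ` for every `x ∈ vertexStarZd s`. The arbitrary-range twin of
`StarWindowBoundZdR` (radius `D`). A `Prop`; nothing asserted. [folklore] -/
def StarWindowBoundZdW (γ : Specification (ZdEdge d) (SUN N)) (t ρ : ℝ) (reach : Site d → ZdEdge d → ℝ)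
    (r : SUN N → SUN N → ℝ) : Prop :=
  ∃ K : Site d → ZdEdge d → ZdEdge d → ℝ,
    (∀ s y x, 0 ≤ K s y x) ∧
    (∀ s x, Summable fun y => K s y x * Real.exp (t * reach s y)) ∧
    (∀ (c : ZdEdge d) (ω η : LGConfig d (SUN N)) (f : LGConfig d (SUN N) → ℝ) (δ : ZdEdge d → ℝ),
      Measurable f → (∃ B, ∀ σ, |f σ| ≤ B) → DependsOn f (starWinZd c : Set (ZdEdge d)) →
      (∀ x, 0 ≤ δ x) →
      (∀ (x : ZdEdge d) (σ τ : LGConfig d (SUN N)), (∀ v, v ≠ x → σ v = τ v) →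
        |f σ - f τ| ≤ δ x * r (σ x) (τ x)) →
        |∫ σ, f σ ∂(γ (starWinZd c) ω) - ∫ σ, f σ ∂(γ (starWinZd c) η)| ≤
          ∑ x ∈ starWinZd c, δ x * ∑' y, K c.1 y x * r (ω y) (η y)) ∧
    ∀ (s : Site d) (x : ZdEdge d), x ∈ vertexStarZd s → ∑' y, K s y x * Real.exp (t * reach s y) ≤ ρ

/-! ### Exhaustion and profiles (real, `1`-Lipschitz in the sup-norm of base points) -/

/-- A link of a vertex star has base point within sup-distance `1` of the vertex: `‖x.1 − s‖ ≤ 1`.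
[folklore] -/
theorem norm_sub_le_one_of_mem_vertexStarZd {s : Site d} {x : ZdEdge d} (hx : x ∈ vertexStarZd s) :
    ‖x.1 - s‖ ≤ 1 := by
  have h := norm_le_of_natAbs_le (a := x.1 - s) (n := 1) fun i => by
    have := natAbs_sub_le_one_of_mem_vertexStarZd hx i
    rwa [Pi.sub_apply]
  exact_mod_cast h

/-- Two links of a vertex star have base points within sup-distance `2`. [folklore] -/
theorem norm_sub_le_two_of_mem_vertexStarZd {s : Site d} {x z : ZdEdge d} (hx : x ∈ vertexStarZd s)
    (hz : z ∈ vertexStarZd s) : ‖x.1 - z.1‖ ≤ 2 := by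
  have h1 := norm_sub_le_one_of_mem_vertexStarZd hx
  have h2 := norm_sub_le_one_of_mem_vertexStarZd hz
  calc ‖x.1 - z.1‖ = ‖(x.1 - s) - (z.1 - s)‖ := by congr 1; abel
    _ ≤ ‖x.1 - s‖ + ‖z.1 - s‖ := norm_sub_le _ _
    _ ≤ 2 := by linarith

/-- The vertex star of `s` lies inside the links based in the box of radius `M` as soon as
`supNormZd s + 1 ≤ M`. [folklore] -/
theorem vertexStarZd_subset_box {s : Site d} {M : ℕ} (hs : supNormZd s + 1 ≤ M) :
    vertexStarZd s ⊆ (box d M) ×ˢ (Finset.univ : Finset (Fin d)) := by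
  intro x hx
  refine Finset.mem_product.2 ⟨mem_box.2 fun i => ?_, Finset.mem_univ _⟩
  have h1 := natAbs_sub_le_one_of_mem_vertexStarZd hx i
  have h2 := natAbs_le_supNormZd s i
  omega

/-- A link based outside the box of radius `M` has `supNormZd > M`. [folklore] -/
theorem lt_supNormZd_of_not_mem_box {x : ZdEdge d} {M : ℕ}
    (hx : x ∉ (box d M) ×ˢ (Finset.univ : Finset (Fin d))) : M < supNormZd x.1 := by
  by_contra h
  refine hx (Finset.mem_product.2 ⟨mem_box.2 fun i => ?_, Finset.mem_univ _⟩)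
  have h2 := natAbs_le_supNormZd x.1 i
  omega

/-- **Exhaustion for the star windows, weighted form.** For every finite `Δ` and level `m` there are a
finite `Λ ⊇ Δ` (the links based in a box) and the real profile `ρ x = M − 1 − ‖x.1‖_∞` with: `ρ ≤ 0` off `Λ`;
`ρ ≤ 0` on the links of `Λ` lying in no star `⊆ Λ` centred at a link of `Λ`; `ρ x ≤ ρ y + reach(c.1, y)` for
`x` in the star of `c` and ANY `y` (the profile is `1`-Lipschitz and `‖x.1 − y.1‖ ≤ reach`); `ρ ≥ m` on `Δ` —
the exhaustion hypothesis of `DobrushinShlosman.subsingleton_gibbsMeasures_of_window_weighted`. [folklore] -/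
theorem exists_starExhaustionW (reach : Site d → ZdEdge d → ℝ)
    (hreach : ∀ (s : Site d), ∀ x ∈ vertexStarZd s, ∀ y : ZdEdge d, ‖x.1 - y.1‖ ≤ reach s y)
    (K : Site d → ZdEdge d → ZdEdge d → ℝ) (Δ : Finset (ZdEdge d)) (m : ℕ) :
    ∃ (Λ : Finset (ZdEdge d)) (ρ : ZdEdge d → ℝ), Δ ⊆ Λ ∧
      (∀ y, y ∉ Λ → ρ y ≤ 0) ∧ (∀ x ∈ Λ, (∀ c ∈ Λ, starWinZd c ⊆ Λ → x ∉ starWinZd c) → ρ x ≤ 0) ∧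
      (∀ c ∈ Λ, starWinZd c ⊆ Λ → ∀ x ∈ starWinZd c, ∀ y, K c.1 y x ≠ 0 → ρ x ≤ ρ y + reach c.1 y) ∧
      (∀ x ∈ Δ, (m : ℝ) ≤ ρ x) := by
  classical
  set B : ℕ := Δ.sup fun x => supNormZd x.1 with hB
  set M : ℕ := B + m + 2 with hM
  refine ⟨(box d M) ×ˢ (Finset.univ : Finset (Fin d)), fun x => (M : ℝ) - 1 - supNormZd x.1,
    ?_, ?_, ?_, ?_, ?_⟩
  · intro x hx
    have hxB : supNormZd x.1 ≤ B := Finset.le_sup (f := fun x : ZdEdge d => supNormZd x.1) hx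
    exact vertexStarZd_subset_box (s := x.1) (by omega) (self_mem_vertexStarZd x)
  · intro y hy
    have h := lt_supNormZd_of_not_mem_box hy
    have h' : (M : ℝ) + 1 ≤ supNormZd y.1 := by exact_mod_cast h
    linarith
  · intro x hx hunc
    -- a link of `Λ` deep inside is covered by its own star
    have hM' : M < supNormZd x.1 + 2 := by
      by_contra h
      exact hunc x hx (vertexStarZd_subset_box (s := x.1) (by omega)) (self_mem_starWinZd x)
    have h' : (M : ℝ) ≤ supNormZd x.1 + 1 := by exact_mod_cast Nat.lt_succ_iff.1 (by omega)
    linarith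
  · intro c _ _ x hx y _
    have h1 := supNormZd_le_supNormZd_add_norm y.1 x.1
    have h2 : ‖y.1 - x.1‖ ≤ reach c.1 y := by rw [norm_sub_rev]; exact hreach c.1 x hx y
    linarith
  · intro x hx
    have hxB : supNormZd x.1 ≤ B := Finset.le_sup (f := fun x : ZdEdge d => supNormZd x.1) hx
    have h' : (supNormZd x.1 : ℝ) ≤ B := by exact_mod_cast hxB
    have hM' : (M : ℝ) = B + m + 2 := by rw [hM]; push_cast; ring
    rw [hM']
    linarith

/-- **The two-set profile for covariance decay, weighted form.** For finite `Δf, Δg` there are a finite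
`Λ ⊇ Δf` and the real profile `ρ x = min(dist(x, Δg) − 2, M − 1 − ‖x.1‖_∞)` with: `ρ ≤ 0` off `Λ`; `ρ ≤ 0` on the
links of `Λ` lying in no star `⊆ Λ` (centred in `Λ`) that avoids `Δg`; `ρ x ≤ ρ y + reach(c.1, y)` along every
star; and `ρ ≥ dist(Δf, Δg) − 2` on `Δf` (`dist` = `setDistEdges`, sup-distance of base points) — the
hypotheses of `DobrushinShlosman.abs_covariance_le_of_window_weighted_exp`. [folklore] -/
theorem exists_starProfileW (reach : Site d → ZdEdge d → ℝ)
    (hreach : ∀ (s : Site d), ∀ x ∈ vertexStarZd s, ∀ y : ZdEdge d, ‖x.1 - y.1‖ ≤ reach s y)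
    (K : Site d → ZdEdge d → ZdEdge d → ℝ) (Δf Δg : Finset (ZdEdge d)) :
    ∃ (Λ : Finset (ZdEdge d)) (ρ : ZdEdge d → ℝ), Δf ⊆ Λ ∧
      (∀ y, y ∉ Λ → ρ y ≤ 0) ∧
      (∀ x ∈ Λ, (∀ c ∈ Λ, starWinZd c ⊆ Λ → (∀ z ∈ starWinZd c, z ∉ Δg) → x ∉ starWinZd c) → ρ x ≤ 0) ∧
      (∀ c ∈ Λ, starWinZd c ⊆ Λ → (∀ z ∈ starWinZd c, z ∉ Δg) → ∀ x ∈ starWinZd c, ∀ y,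
        K c.1 y x ≠ 0 → ρ x ≤ ρ y + reach c.1 y) ∧
      (∀ x ∈ Δf, setDistEdges Δf Δg - 2 ≤ ρ x) := by
  classical
  set B : ℕ := Δf.sup fun x => supNormZd x.1 with hB
  set M : ℕ := B + ⌈setDistEdges Δf Δg⌉₊ + 2 with hM
  refine ⟨(box d M) ×ˢ (Finset.univ : Finset (Fin d)),
    fun x => min (linkSetDist Δg x - 2) ((M : ℝ) - 1 - supNormZd x.1), ?_, ?_, ?_, ?_, ?_⟩
  · intro x hx
    have hxB : supNormZd x.1 ≤ B := Finset.le_sup (f := fun x : ZdEdge d => supNormZd x.1) hx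
    exact vertexStarZd_subset_box (s := x.1) (by omega) (self_mem_vertexStarZd x)
  · intro y hy
    have h := lt_supNormZd_of_not_mem_box hy
    have h' : (M : ℝ) + 1 ≤ supNormZd y.1 := by exact_mod_cast h
    exact (min_le_right _ _).trans (by linarith)
  · intro x hx hunc
    by_cases hdeep : supNormZd x.1 + 2 ≤ M
    · -- the own star of `x` lies inside `Λ`, hence meets `Δg`: `dist(x, Δg) ≤ 2`
      have hsub := vertexStarZd_subset_box (s := x.1) (M := M) (by omega)
      have hmeet : ∃ z ∈ starWinZd x, z ∈ Δg := by
        by_contra hcon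
        exact hunc x hx hsub (fun z hz hzg => hcon ⟨z, hz, hzg⟩) (self_mem_starWinZd x)
      obtain ⟨z, hz, hzg⟩ := hmeet
      have h1 : linkSetDist Δg x ≤ linkSetDist Δg z + ‖x.1 - z.1‖ := linkSetDist_le_add_norm Δg x z
      rw [linkSetDist_eq_zero_of_mem hzg, zero_add] at h1
      have h2 := norm_sub_le_two_of_mem_vertexStarZd (self_mem_vertexStarZd x) hz
      exact (min_le_left _ _).trans (by linarith)
    · have h' : (M : ℝ) ≤ supNormZd x.1 + 1 := by exact_mod_cast Nat.lt_succ_iff.1 (by omega)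
      exact (min_le_right _ _).trans (by linarith)
  · intro c _ _ _ x hx y _
    have h1 := supNormZd_le_supNormZd_add_norm y.1 x.1
    have h2 : ‖y.1 - x.1‖ ≤ reach c.1 y := by rw [norm_sub_rev]; exact hreach c.1 x hx y
    have h3 : linkSetDist Δg x ≤ linkSetDist Δg y + ‖x.1 - y.1‖ := linkSetDist_le_add_norm Δg x y
    have h4 : ‖x.1 - y.1‖ ≤ reach c.1 y := hreach c.1 x hx y
    calc min (linkSetDist Δg x - 2) ((M : ℝ) - 1 - supNormZd x.1)
        ≤ min (linkSetDist Δg y - 2 + reach c.1 y) ((M : ℝ) - 1 - supNormZd y.1 + reach c.1 y) :=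
          min_le_min (by linarith) (by linarith)
      _ = min (linkSetDist Δg y - 2) ((M : ℝ) - 1 - supNormZd y.1) + reach c.1 y := min_add_add_right _ _ _
  · intro x hx
    have hxB : supNormZd x.1 ≤ B := Finset.le_sup (f := fun x : ZdEdge d => supNormZd x.1) hx
    have h' : (supNormZd x.1 : ℝ) ≤ B := by exact_mod_cast hxB
    have hM' : (M : ℝ) = B + ⌈setDistEdges Δf Δg⌉₊ + 2 := by rw [hM]; push_cast; ring
    have hceil := Nat.le_ceil (setDistEdges Δf Δg)
    refine le_min ?_ ?_
    · linarith [setDistEdges_le_linkSetDist (Λ₂ := Δg) hx]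
    · rw [hM']; linarith

/-! ### The door: uniqueness and clustering of every Gibbs measure -/

/-- **UNIQUENESS through the weighted star door (arbitrary range).** For a specification `γ` on the links
of `ℤ^d` with `SU(N)` spins (`IsSpecification`) with at least one Gibbs measure, the weighted star window
bound with rate `t > 0`, received sum `ρ < 1` and a reach dominating the sup-distance from the star
(`‖x.1 − y.1‖ ≤ reach(s, y)` for `x ∈ ⋆_s`), for the Frobenius weight, gives `HasUniqueGibbsMeasure γ`
(Literature `DobrushinShlosman.subsingleton_gibbsMeasures_of_window_weighted` — the weighted
Dobrushin–Shlosman uniqueness theorem for window kernels of infinite range, its first use in the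
programme; exhaustion `exists_starExhaustionW`; Frobenius-coordinate closing step `suEntries`). [folklore] -/
theorem hasUniqueGibbsMeasure_of_starWindowBoundZdW {γ : Specification (ZdEdge d) (SUN N)}
    (hγ : IsSpecification γ) (hne : (gibbsMeasures γ).Nonempty) {t ρ : ℝ} (ht : 0 < t)
    (hρ0 : 0 ≤ ρ) (hρ1 : ρ < 1) {reach : Site d → ZdEdge d → ℝ} (hreach0 : ∀ s y, 0 ≤ reach s y)
    (hreach : ∀ (s : Site d), ∀ x ∈ vertexStarZd s, ∀ y : ZdEdge d, ‖x.1 - y.1‖ ≤ reach s y)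
    (h : StarWindowBoundZdW d N γ t ρ reach suFrobDist) :
    HasUniqueGibbsMeasure γ := by
  classical
  haveI : SecondCountableTopology (Matrix (Fin N) (Fin N) ℂ) :=
    inferInstanceAs (SecondCountableTopology (Fin N → Fin N → ℂ))
  haveI : SecondCountableTopology (SUN N) := Topology.IsEmbedding.subtypeVal.secondCountableTopology
  obtain ⟨K, hK0, hKs, hcontract, hsum⟩ := h
  have hR₀ : (0 : ℝ) ≤ 2 * Real.sqrt N := by positivity
  have hA : ∀ a b : SUN N, dist (suEntries a) (suEntries b) ≤ 1 * suFrobDist a b := fun a b => by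
    rw [one_mul]; exact dist_suEntries_le_suFrobDist a b
  refine ⟨?_, hne⟩
  exact DobrushinShlosman.subsingleton_gibbsMeasures_of_window_weighted hγ suFrobDist_nonneg suFrobDist_le
    hR₀ suFrobDist_self (win := starWinZd) (K := fun c => K c.1) (fun c y x => hK0 _ _ _) hcontract ht
    (d := fun c y _ => reach c.1 y) (fun c y _ => hreach0 _ _) (fun c x => hKs c.1 x) hρ0 hρ1
    (fun c x hx => hsum c.1 x hx) (exists_starExhaustionW reach hreach K) suEntries
    measurableSpace_specialUnitaryGroup_eq_comap zero_le_one hA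

/-- **EXPONENTIAL CLUSTERING OF EVERY GIBBS MEASURE through the weighted star door (arbitrary range),
directly in infinite volume.** Under the weighted star window bound (rate `t ≥ 0`, received sum `ρ < 1`,
reach dominating the sup-distance from the star, Frobenius weight), every Gibbs measure `μ` of `γ` satisfies,
for bounded measurable `f, g` reading the finite link sets `Δf, Δg` with Frobenius-Lipschitz vectors
`δf, δg`: `|cov_μ(f, g)| ≤ 2(2√N)² e^{2t} e^{−t·dist(Δf, Δg)} (Σ δf)(Σ δg)`, `dist` = `setDistEdges`
(Literature `DobrushinShlosman.abs_covariance_le_of_window_weighted_exp`, two-set profile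
`exists_starProfileW`). [folklore] -/
theorem abs_covariance_le_of_starWindowBoundZdW {γ : Specification (ZdEdge d) (SUN N)}
    (hγ : IsSpecification γ) {t ρ : ℝ} (ht : 0 ≤ t) (hρ0 : 0 ≤ ρ) (hρ1 : ρ < 1)
    {reach : Site d → ZdEdge d → ℝ} (hreach0 : ∀ s y, 0 ≤ reach s y)
    (hreach : ∀ (s : Site d), ∀ x ∈ vertexStarZd s, ∀ y : ZdEdge d, ‖x.1 - y.1‖ ≤ reach s y)
    (h : StarWindowBoundZdW d N γ t ρ reach suFrobDist)
    {μ : Measure (LGConfig d (SUN N))} (hμ : IsGibbsMeasure γ μ)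
    {f g : LGConfig d (SUN N) → ℝ} (hfm : Measurable f) (hgm : Measurable g) {Bf Bg : ℝ}
    (hBf : ∀ σ, |f σ| ≤ Bf) (hBg : ∀ σ, |g σ| ≤ Bg) {Δf Δg : Finset (ZdEdge d)}
    (hfdep : DependsOn f (Δf : Set (ZdEdge d))) (hgdep : DependsOn g (Δg : Set (ZdEdge d)))
    {δf δg : ZdEdge d → ℝ} (hδf : IsLipBound suFrobDist f δf) (hδg : IsLipBound suFrobDist g δg) :
    |cov[f, g; μ]| ≤ 2 * (2 * Real.sqrt N) ^ 2 * Real.exp (2 * t) *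
      Real.exp (-(t * setDistEdges Δf Δg)) * (∑ x ∈ Δf, δf x) * ∑ y ∈ Δg, δg y := by
  classical
  obtain ⟨K, hK0, hKs, hcontract, hsum⟩ := h
  have hR₀ : (0 : ℝ) ≤ 2 * Real.sqrt N := by positivity
  obtain ⟨Λ, ρf, hΔΛ, hout, hunc, hlip, hm⟩ := exists_starProfileW reach hreach K Δf Δg
  have key := DobrushinShlosman.abs_covariance_le_of_window_weighted_exp hγ suFrobDist_nonneg suFrobDist_le
    hR₀ suFrobDist_self (win := starWinZd) (K := fun c => K c.1) (fun c y x => hK0 _ _ _) hcontract ht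
    (d := fun c y _ => reach c.1 y) (fun c y _ => hreach0 _ _) (fun c x => hKs c.1 x) hρ0 hρ1
    (fun c x hx => hsum c.1 x hx) hμ hfm hgm hBf hBg hfdep hgdep hδf hδg Λ hΔΛ ρf hout hunc hlip hm
  refine key.trans (le_of_eq ?_)
  have : Real.exp (-(t * (setDistEdges Δf Δg - 2))) = Real.exp (2 * t) * Real.exp (-(t * setDistEdges Δf Δg)) := by
    rw [← Real.exp_add]; congr 1; ring
  rw [this]; ring

/-! ### The plug into the tier-2 `ℤ^d` currency: `PerturbedMassGapAtS` -/

/-- **THE WEIGHTED STAR DOOR FOR THE TIER-2 PERTURBED SPECIFICATIONS ⇒ `PerturbedMassGapAtS`.** For a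
link-summable potential `W` on `ℤ^d` with continuous terms depending only on their own links (rb-p1's
`perturbedYMS`), a weighted star window bound for `perturbedYMS (fundamentalRep (Fin N)) (N β) W` with rate
`t > 0`, received sum `0 ≤ ρ < 1` and a reach dominating the sup-distance from the star gives
`PerturbedMassGapAtS d N β W`: the DLR state exists (`perturbedGibbsMeasuresS_nonempty`) and is unique
(`hasUniqueGibbsMeasure_of_starWindowBoundZdW`), and every DLR state clusters exponentially in the
Shen–Zhu–Zhu form with rate `t` and `c₁ = 2(2√N)² n² e^{2t}` (`abs_covariance_le_of_starWindowBoundZdW`).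
Infinite volume throughout; no range hypothesis on `W`. [folklore] -/
theorem perturbedMassGapAtS_of_starWindowBoundZdW {β t ρ : ℝ} {W : Potential (ZdEdge d) (SUN N)}
    {Bs : Finset (ZdEdge d) → ℝ} (hWs : IsLinkSummable W Bs) (hWc : ∀ X, Continuous (W X))
    (hWdep : ∀ X, DependsOn (W X) (↑X : Set (ZdEdge d))) (ht : 0 < t) (hρ0 : 0 ≤ ρ) (hρ1 : ρ < 1)
    {reach : Site d → ZdEdge d → ℝ} (hreach0 : ∀ s y, 0 ≤ reach s y)
    (hreach : ∀ (s : Site d), ∀ x ∈ vertexStarZd s, ∀ y : ZdEdge d, ‖x.1 - y.1‖ ≤ reach s y)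
    (h : StarWindowBoundZdW d N (perturbedYMS (d := d) (fundamentalRep (Fin N)) (N * β) W) t ρ reach
      suFrobDist) :
    PerturbedMassGapAtS d N β W := by
  classical
  haveI : SecondCountableTopology (Matrix (Fin N) (Fin N) ℂ) :=
    inferInstanceAs (SecondCountableTopology (Fin N → Fin N → ℂ))
  haveI : SecondCountableTopology (SUN N) := Topology.IsEmbedding.subtypeVal.secondCountableTopology
  have hγ : IsSpecification (perturbedYMS (d := d) (fundamentalRep (Fin N)) (N * β) W) :=
    isSpecification_perturbedYMS _ (continuous_fundamentalRep (Fin N)) _ hWs hWc hWdep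
  have hne : (perturbedGibbsMeasuresS (d := d) (fundamentalRep (Fin N)) (N * β) W).Nonempty :=
    perturbedGibbsMeasuresS_nonempty _ (continuous_fundamentalRep (Fin N)) _ hWs hWc hWdep
  refine ⟨hasUniqueGibbsMeasure_of_starWindowBoundZdW hγ hne ht hρ0 hρ1 hreach0 hreach h, fun μ hμ => ?_⟩
  -- clustering of the DLR state `μ` (adapted from `perturbedMassGapAt_of_starWindowBoundZdR`)
  have hμ' : IsGibbsMeasure (perturbedYMS (d := d) (fundamentalRep (Fin N)) (N * β) W) μ := hμ
  haveI := hμ'.isProbabilityMeasure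
  refine ⟨t, ht, fun n => ⟨2 * (2 * Real.sqrt N) ^ 2 * (n : ℝ) ^ 2 * exp (2 * t), ?_⟩⟩
  intro F₁ F₂ Λ₁ Λ₂ K₁ K₂ h₁ h₂ _ hF₁ hF₂
  have hA : ∀ a b : SUN N, dist (suEntries a) (suEntries b) ≤ 1 * suFrobDist a b := fun a b => by
    rw [one_mul]; exact dist_suEntries_le_suFrobDist a b
  have key := abs_covariance_le_of_starWindowBoundZdW hγ ht.le hρ0 hρ1 hreach0 hreach h hμ'
    hF₁.measurable hF₂.measurable hF₁.abs_le hF₂.abs_le hF₁.dependsOn hF₂.dependsOn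
    (hF₁.isLipBound zero_le_one hA) (hF₂.isLipBound zero_le_one hA)
  have hK₁ : (0 : ℝ) ≤ K₁ := K₁.2
  have hK₂ : (0 : ℝ) ≤ K₂ := K₂.2
  have hn₁ : (Λ₁.card : ℝ) ≤ n := by exact_mod_cast h₁
  have hn₂ : (Λ₂.card : ℝ) ≤ n := by exact_mod_cast h₂
  have hsum₁ : ∑ y ∈ Λ₁, (if y ∈ Λ₁ then 1 * (K₁ : ℝ) else 0) ≤ n * K₁ := by
    rw [Finset.sum_ite_of_true (fun y hy => hy), Finset.sum_const, nsmul_eq_mul, one_mul]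
    exact mul_le_mul_of_nonneg_right hn₁ hK₁
  have hsum₂ : ∑ y ∈ Λ₂, (if y ∈ Λ₂ then 1 * (K₂ : ℝ) else 0) ≤ n * K₂ := by
    rw [Finset.sum_ite_of_true (fun y hy => hy), Finset.sum_const, nsmul_eq_mul, one_mul]
    exact mul_le_mul_of_nonneg_right hn₂ hK₂
  have hsum₁0 : 0 ≤ ∑ y ∈ Λ₁, (if y ∈ Λ₁ then 1 * (K₁ : ℝ) else 0) :=
    Finset.sum_nonneg fun y hy => by rw [if_pos hy]; positivity
  have hexp : exp (-(t * setDistEdges Λ₁ Λ₂)) = exp (-t * setDistEdges Λ₁ Λ₂) := by ring_nf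
  calc |cov[F₁, F₂; μ]|
      ≤ 2 * (2 * Real.sqrt N) ^ 2 * exp (2 * t) * exp (-(t * setDistEdges Λ₁ Λ₂)) *
          (∑ y ∈ Λ₁, (if y ∈ Λ₁ then 1 * (K₁ : ℝ) else 0)) *
          ∑ y ∈ Λ₂, (if y ∈ Λ₂ then 1 * (K₂ : ℝ) else 0) := key
    _ ≤ 2 * (2 * Real.sqrt N) ^ 2 * exp (2 * t) * exp (-(t * setDistEdges Λ₁ Λ₂)) *
          (n * K₁) * (n * K₂) := by gcongr
    _ = 2 * (2 * Real.sqrt N) ^ 2 * (n : ℝ) ^ 2 * exp (2 * t) * exp (-t * setDistEdges Λ₁ Λ₂) *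
          ((K₁ : ℝ) * K₂) := by rw [hexp]; ring
    _ ≤ 2 * (2 * Real.sqrt N) ^ 2 * (n : ℝ) ^ 2 * exp (2 * t) * exp (-t * setDistEdges Λ₁ Λ₂) *
          ((K₁ : ℝ) * K₂ + Real.sqrt (∫ U, F₁ U ^ 2 ∂μ) * Real.sqrt (∫ U, F₂ U ^ 2 ∂μ)) := by
        gcongr
        exact le_add_of_nonneg_right (by positivity)

end Summit.Ventures.YMGap.RobustBall

end
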